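import Summits.ABC.ABC.Theorems.IneffectiveSubspaceDeepRegimeABCRoughPowerfulTail

/-!
# Line `Sketch` — crux `IneffectiveSubspace.DepthCountedABC` (stmt-ABC-14938): Ridout localisation of abc on a class

CERTIFICATE (registered certificate stub `stub_ridoutLocalAllPowerRichIff`, not load-bearing in `DepthCountedABC_of`;
lands `--supports stmt-ABC-14938`).  The landed Ridout normal
form of the crux (`stub_roughPowerfulCellIff`, p140411) says: abc with exponent `1+ε` on a cell
`ω₅(abc) ≤ K` is EQUIVALENT to the same statement on the triples of the cell whose `y`-rough
powerful excess `X_y(abc) := Σ_{p > y, p ∣ abc} (v_p(abc) − 1)·log p` is `≥ θ·log c` (`0 < θ`,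
`θ(1+ε) < ε`; `y, C` free).  Its proof never uses the cell condition.  This file records the general
statement — for an ARBITRARY side condition `P ε a b c` (allowed to depend on the exponent
parameter) abc with exponent `1+ε` on `P` is equivalent to abc with exponent `1+ε` on the
rough-powerful part of `P` (`ridoutLocal_abc_iff`) — and applies it to the P-statement of line
`Sketch` (the core `stub_allPowerRich`: all three members power-rich at level `δ`), whose side
condition DOES depend on `δ` (`ridoutLocal_allPowerRich_iff`).  In words: the open content of the
P core sits on the power-rich triples whose powerful mass `≥ c^θ` is carried by primes `> y`; the
all-power-rich triples built from small primes (`11² + 3²5⁶7³ = 2²¹·23` at `δ = 1/10`, …; `X_y = 0`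
for `y ≥ 23`) are settled by Ridout's theorem, cell by cell.

PROOF (`←`, verbatim the landed `depthCountedABC_of_roughPowerfulCell` with the cell hypothesis
replaced by `P`).  Given `ε` put `η := ε/(4(1+ε))`, `θ := 2η`; take `y, C₀` from the hypothesis and
`B` from Ridout (`DeepRegimeABC.ridoutCoreBound_holds y η`: CORED triples are bounded); answer
`C := max (max C₀ (exp (log 2/η))) (B+1)`.  A cored triple has `c ≤ B < C ≤ C·rad^(1+ε)`; a coreless
violator of `c < C·rad^(1+ε)` has `(1+ε) log rad ≤ log c`, `Σ_{p>y} log p ≤ log rad`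
(`DeepRegimeABC.sum_rough_log_le_log_rad`), rough mass `> (1−η) log c − log 2`
(`DeepRegimeABC.roughMass_gt_of_coreMass_lt`) and `η log c ≥ log 2`, hence excess `≥ θ log c`
(`DeepRegimeABC.roughExcess_eq_roughMass_sub`), and the hypothesis bounds it — contradiction.
(`→`: ignore the excess hypothesis, `y := 0`.)

Sources: elementary bookkeeping (folklore) over the landed `DeepRegimeABC` lemmas; Ridout's theorem
(Bombieri–Gubler Thm. 6.2.3) enters only through the PROVED `DeepRegimeABC.ridoutCoreBound_holds`.
Deliberately NOT here: any claim about the P core itself (open), the crux, or the T cores; no new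
definitions are introduced.
-/

-- `Summit.<Summit>.<Problem>` is the mandated summit-side namespace (CONVENTIONS §2); for the
-- single-conjunct summit `ABC` the two coincide, so the duplicate `ABC.ABC` is deliberate.
set_option linter.dupNamespace false

namespace Summit.ABC.ABC.Theorems.DepthCountedABC

open Literature.NumberTheory.DiophantineGeometry UniqueFactorizationMonoid

/-- **Localisation (`←`): abc on the rough-powerful part of `P ε` implies abc on `P ε`.**  Given
`ε`, put `η := ε/(4(1+ε))`, `θ := 2η`, take `y, C₀` from the hypothesis and `B` from
`DeepRegimeABC.ridoutCoreBound_holds y η`; cored triples are bounded by `B`, a coreless violator of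
`c < C·rad^(1+ε)` has rough powerful excess `≥ θ log c` and is bounded by the hypothesis. [folklore] -/
theorem ridoutLocal_abc_of_rough (P : ℝ → ℕ → ℕ → ℕ → Prop)
    (hT : ∀ ε : ℝ, 0 < ε → ∀ θ : ℝ, 0 < θ → θ * (1 + ε) < ε → ∃ y : ℕ, ∃ C : ℝ, 0 < C ∧
      ∀ a b c : ℕ, IsABCTriple a b c → P ε a b c →
        θ * Real.log c ≤
          ∑ p ∈ (a * b * c).primeFactors.filter (fun p => ¬ p ≤ y),
            (((a * b * c).factorization p : ℝ) - 1) * Real.log p →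
        (c : ℝ) < C * ((rad a b c : ℕ) : ℝ) ^ (1 + ε)) :
    ∀ ε : ℝ, 0 < ε → ∃ C : ℝ, 0 < C ∧ ∀ a b c : ℕ, IsABCTriple a b c → P ε a b c →
      (c : ℝ) < C * ((rad a b c : ℕ) : ℝ) ^ (1 + ε) := by
  -- adapted from Summits/ABC/ABC/Theorems/IneffectiveSubspaceDepthCountedABCStubRoughPowerfulCellIff.lean
  -- (`depthCountedABC_of_roughPowerfulCell`), the cell hypothesis replaced by `P ε`
  intro ε hε
  have hε1 : (0 : ℝ) < 1 + ε := by linarith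
  set η : ℝ := ε / (4 * (1 + ε)) with hη
  have hη0 : 0 < η := by positivity
  have hη4 : 4 * η * (1 + ε) = ε := by
    rw [hη]
    field_simp
  obtain ⟨y, C₀, hC₀, hmain⟩ :=
    hT ε hε (2 * η) (by positivity) (by linarith [hη4])
  obtain ⟨B, hB⟩ := DeepRegimeABC.ridoutCoreBound_holds y η hη0
  set c₁ : ℝ := Real.exp (Real.log 2 / η) with hc₁
  have hc₁1 : 1 ≤ c₁ := Real.one_le_exp (div_nonneg (Real.log_nonneg (by norm_num)) hη0.le)
  set C : ℝ := max (max C₀ c₁) (B + 1) with hC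
  have hC0 : C₀ ≤ C := (le_max_left _ _).trans (le_max_left _ _)
  have hC1 : c₁ ≤ C := (le_max_right _ _).trans (le_max_left _ _)
  have hCB : B + 1 ≤ C := le_max_right _ _
  have hCone : 1 ≤ C := hc₁1.trans hC1
  refine ⟨C, hC₀.trans_le hC0, fun a b c habc hP => ?_⟩
  obtain ⟨ha, -, hsum, -⟩ := id habc
  have hc : 0 < c := by omega
  have hcR : (0 : ℝ) < (c : ℝ) := by exact_mod_cast hc
  have hrad1 : (1 : ℝ) ≤ ((rad a b c : ℕ) : ℝ) := by
    rw [rad_def]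
    exact_mod_cast Nat.pos_of_ne_zero UniqueFactorizationMonoid.radical_ne_zero
  have hrad0 : (0 : ℝ) < ((rad a b c : ℕ) : ℝ) := by linarith
  have hrpow1 : (1 : ℝ) ≤ ((rad a b c : ℕ) : ℝ) ^ (1 + ε) :=
    DeepRegimeABC.one_le_rad_rpow' a b c hε
  have hrpow0 : (0 : ℝ) ≤ ((rad a b c : ℕ) : ℝ) ^ (1 + ε) := zero_le_one.trans hrpow1
  by_cases hcore :
      (∑ p ∈ (a * b * c).primeFactors.filter (fun p => p ≤ y),
            ((a * b * c).factorization p : ℝ) * Real.log p)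
          + Real.log ((c : ℝ) / ((min a b : ℕ) : ℝ)) < (2 + η) * Real.log c
  · -- CORELESS: a violator has rough powerful excess `≥ θ log c`, so the hypothesis bounds it
    by_contra hnot
    push Not at hnot
    have hc_ge : c₁ ≤ (c : ℝ) := by
      calc c₁ ≤ C := hC1
        _ = C * 1 := (mul_one C).symm
        _ ≤ C * ((rad a b c : ℕ) : ℝ) ^ (1 + ε) :=
            mul_le_mul_of_nonneg_left hrpow1 (by linarith)
        _ ≤ (c : ℝ) := hnot
    have hlogc : Real.log 2 / η ≤ Real.log c := by
      rw [← Real.log_exp (Real.log 2 / η)]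
      exact Real.log_le_log (Real.exp_pos _) hc_ge
    have hηL : Real.log 2 ≤ η * Real.log c := by
      rw [div_le_iff₀ hη0] at hlogc
      linarith
    have hrc : ((rad a b c : ℕ) : ℝ) ^ (1 + ε) ≤ (c : ℝ) := by
      calc ((rad a b c : ℕ) : ℝ) ^ (1 + ε) = 1 * ((rad a b c : ℕ) : ℝ) ^ (1 + ε) := (one_mul _).symm
        _ ≤ C * ((rad a b c : ℕ) : ℝ) ^ (1 + ε) := mul_le_mul_of_nonneg_right hCone hrpow0
        _ ≤ (c : ℝ) := hnot
    have hlogrc : (1 + ε) * Real.log ((rad a b c : ℕ) : ℝ) ≤ Real.log c := by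
      have h := Real.log_le_log (by positivity) hrc
      rwa [Real.log_rpow hrad0] at h
    have hS := DeepRegimeABC.sum_rough_log_le_log_rad y a b c
    have hρ : Real.log ((rad a b c : ℕ) : ℝ) ≤ Real.log c - 4 * η * Real.log c := by
      have h1 : (1 + ε) * (Real.log c - 4 * η * Real.log c) = Real.log c := by
        have h2 : (1 + ε) * (Real.log c - 4 * η * Real.log c)
            = (1 + ε) * Real.log c - (4 * η * (1 + ε)) * Real.log c := by ring
        rw [h2, hη4]
        ring
      refine le_of_mul_le_mul_left ?_ hε1
      rw [h1]
      exact hlogrc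
    have hR := DeepRegimeABC.roughMass_gt_of_coreMass_lt (y := y) habc hcore
    have hX : 2 * η * Real.log c ≤
        ∑ p ∈ (a * b * c).primeFactors.filter (fun p => ¬ p ≤ y),
          (((a * b * c).factorization p : ℝ) - 1) * Real.log p := by
      rw [DeepRegimeABC.roughExcess_eq_roughMass_sub]
      linarith [hR, hS, hρ, hηL]
    have hlt := hmain a b c habc hP hX
    have hCC : C₀ * ((rad a b c : ℕ) : ℝ) ^ (1 + ε) ≤ C * ((rad a b c : ℕ) : ℝ) ^ (1 + ε) :=
      mul_le_mul_of_nonneg_right hC0 hrpow0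
    linarith
  · -- CORED: bounded by Ridout, absorbed since `rad^(1+ε) ≥ 1`
    have hcB : (c : ℝ) ≤ B := hB a b c habc (not_lt.mp hcore)
    have hCnn : (0 : ℝ) ≤ C := zero_le_one.trans hCone
    calc (c : ℝ) ≤ B := hcB
      _ < B + 1 := by linarith
      _ ≤ C := hCB
      _ = C * 1 := (mul_one _).symm
      _ ≤ C * ((rad a b c : ℕ) : ℝ) ^ (1 + ε) := mul_le_mul_of_nonneg_left hrpow1 hCnn

/-- **Localisation (`→`): abc on `P ε` implies abc on the rough-powerful part of `P ε`** (ignore the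
excess hypothesis; `y := 0`). [folklore] -/
theorem ridoutLocal_rough_of_abc (P : ℝ → ℕ → ℕ → ℕ → Prop)
    (h : ∀ ε : ℝ, 0 < ε → ∃ C : ℝ, 0 < C ∧ ∀ a b c : ℕ, IsABCTriple a b c → P ε a b c →
      (c : ℝ) < C * ((rad a b c : ℕ) : ℝ) ^ (1 + ε)) :
    ∀ ε : ℝ, 0 < ε → ∀ θ : ℝ, 0 < θ → θ * (1 + ε) < ε → ∃ y : ℕ, ∃ C : ℝ, 0 < C ∧
      ∀ a b c : ℕ, IsABCTriple a b c → P ε a b c →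
        θ * Real.log c ≤
          ∑ p ∈ (a * b * c).primeFactors.filter (fun p => ¬ p ≤ y),
            (((a * b * c).factorization p : ℝ) - 1) * Real.log p →
        (c : ℝ) < C * ((rad a b c : ℕ) : ℝ) ^ (1 + ε) := by
  intro ε hε θ _ _
  obtain ⟨C, hC, hh⟩ := h ε hε
  exact ⟨0, C, hC, fun a b c habc hP _ => hh a b c habc hP⟩

/-- **Ridout localisation of abc on a class.**  For any side condition `P ε a b c`, abc with exponent
`1+ε` on `P ε` (`∀ ε > 0 ∃ C ∀ abc triples in P ε, c < C·rad(abc)^(1+ε)`) is EQUIVALENT to abc with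
exponent `1+ε` on the triples of `P ε` whose `y`-rough powerful excess
`Σ_{p>y, p∣abc}(v_p(abc) − 1) log p` is `≥ θ·log c` (`0 < θ`, `θ(1+ε) < ε`; `y, C` free).  With
`P ε a b c := (ω₅(abc) ≤ K)` this is the landed `stub_roughPowerfulCellIff`, cell by cell.
[folklore] -/
theorem ridoutLocal_abc_iff (P : ℝ → ℕ → ℕ → ℕ → Prop) :
    (∀ ε : ℝ, 0 < ε → ∃ C : ℝ, 0 < C ∧ ∀ a b c : ℕ, IsABCTriple a b c → P ε a b c →
      (c : ℝ) < C * ((rad a b c : ℕ) : ℝ) ^ (1 + ε)) ↔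
    (∀ ε : ℝ, 0 < ε → ∀ θ : ℝ, 0 < θ → θ * (1 + ε) < ε → ∃ y : ℕ, ∃ C : ℝ, 0 < C ∧
      ∀ a b c : ℕ, IsABCTriple a b c → P ε a b c →
        θ * Real.log c ≤
          ∑ p ∈ (a * b * c).primeFactors.filter (fun p => ¬ p ≤ y),
            (((a * b * c).factorization p : ℝ) - 1) * Real.log p →
        (c : ℝ) < C * ((rad a b c : ℕ) : ℝ) ^ (1 + ε)) :=
  ⟨ridoutLocal_rough_of_abc P, ridoutLocal_abc_of_rough P⟩

/-- **The P core of line `Sketch`, localised.**  The registered core `stub_allPowerRich` (abc with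
exponent `1+δ` on the cell `ω₅(abc) ≤ K` for the triples all three of whose members are power-rich at
level `δ`: `rad(m)^(1+δ)·c^δ < m`) is equivalent to the same statement restricted to the triples
whose `y`-rough powerful excess of `abc` is `≥ θ·log c` (`0 < θ`, `θ(1+δ) < δ`; `y, C` free):
`ridoutLocal_abc_iff` with the `δ`-dependent side condition "cell `K` ∧ all power-rich at level `δ`",
cell by cell. [folklore] -/
theorem ridoutLocal_allPowerRich_iff :
    (∀ K : ℕ, ∀ δ : ℝ, 0 < δ → ∃ C : ℝ, 0 < C ∧ ∀ a b c : ℕ, IsABCTriple a b c →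
      ((a * b * c).primeFactors.filter (fun p => 5 ≤ (a * b * c).factorization p)).card ≤ K →
      ((radical a : ℕ) : ℝ) ^ (1 + δ) * (c : ℝ) ^ δ < (a : ℝ) →
      ((radical b : ℕ) : ℝ) ^ (1 + δ) * (c : ℝ) ^ δ < (b : ℝ) →
      ((radical c : ℕ) : ℝ) ^ (1 + δ) * (c : ℝ) ^ δ < (c : ℝ) →
      (c : ℝ) < C * ((rad a b c : ℕ) : ℝ) ^ (1 + δ)) ↔
    (∀ K : ℕ, ∀ δ : ℝ, 0 < δ → ∀ θ : ℝ, 0 < θ → θ * (1 + δ) < δ → ∃ y : ℕ, ∃ C : ℝ, 0 < C ∧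
      ∀ a b c : ℕ, IsABCTriple a b c →
      ((a * b * c).primeFactors.filter (fun p => 5 ≤ (a * b * c).factorization p)).card ≤ K →
      ((radical a : ℕ) : ℝ) ^ (1 + δ) * (c : ℝ) ^ δ < (a : ℝ) →
      ((radical b : ℕ) : ℝ) ^ (1 + δ) * (c : ℝ) ^ δ < (b : ℝ) →
      ((radical c : ℕ) : ℝ) ^ (1 + δ) * (c : ℝ) ^ δ < (c : ℝ) →
        θ * Real.log c ≤
          ∑ p ∈ (a * b * c).primeFactors.filter (fun p => ¬ p ≤ y),
            (((a * b * c).factorization p : ℝ) - 1) * Real.log p →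
        (c : ℝ) < C * ((rad a b c : ℕ) : ℝ) ^ (1 + δ)) := by
  constructor
  · intro h K
    have hK := ridoutLocal_rough_of_abc
      (fun δ a b c =>
        ((a * b * c).primeFactors.filter (fun p => 5 ≤ (a * b * c).factorization p)).card ≤ K ∧
        ((radical a : ℕ) : ℝ) ^ (1 + δ) * (c : ℝ) ^ δ < (a : ℝ) ∧
        ((radical b : ℕ) : ℝ) ^ (1 + δ) * (c : ℝ) ^ δ < (b : ℝ) ∧
        ((radical c : ℕ) : ℝ) ^ (1 + δ) * (c : ℝ) ^ δ < (c : ℝ))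
      (fun δ hδ => by
        obtain ⟨C, hC, hh⟩ := h K δ hδ
        exact ⟨C, hC, fun a b c habc hP => hh a b c habc hP.1 hP.2.1 hP.2.2.1 hP.2.2.2⟩)
    intro δ hδ θ hθ hθδ
    obtain ⟨y, C, hC, hh⟩ := hK δ hδ θ hθ hθδ
    exact ⟨y, C, hC, fun a b c habc h1 h2 h3 h4 hX => hh a b c habc ⟨h1, h2, h3, h4⟩ hX⟩
  · intro h K
    have hK := ridoutLocal_abc_of_rough
      (fun δ a b c =>
        ((a * b * c).primeFactors.filter (fun p => 5 ≤ (a * b * c).factorization p)).card ≤ K ∧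
        ((radical a : ℕ) : ℝ) ^ (1 + δ) * (c : ℝ) ^ δ < (a : ℝ) ∧
        ((radical b : ℕ) : ℝ) ^ (1 + δ) * (c : ℝ) ^ δ < (b : ℝ) ∧
        ((radical c : ℕ) : ℝ) ^ (1 + δ) * (c : ℝ) ^ δ < (c : ℝ))
      (fun δ hδ θ hθ hθδ => by
        obtain ⟨y, C, hC, hh⟩ := h K δ hδ θ hθ hθδ
        exact ⟨y, C, hC, fun a b c habc hP hX =>
          hh a b c habc hP.1 hP.2.1 hP.2.2.1 hP.2.2.2 hX⟩)
    intro δ hδ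
    obtain ⟨C, hC, hh⟩ := hK δ hδ
    exact ⟨C, hC, fun a b c habc h1 h2 h3 h4 => hh a b c habc ⟨h1, h2, h3, h4⟩⟩

/-- **Registered certificate stub `stub_ridoutLocalAllPowerRichIff` (line `Sketch`, crux stmt-ABC-14938):
the P core `stub_allPowerRich` is equivalent to its Ridout localisation** (verbatim
`ridoutLocal_allPowerRich_iff`, stated with fully qualified names as registered). [folklore] -/
theorem stub_ridoutLocalAllPowerRichIff :
    (∀ K : ℕ, ∀ δ : ℝ, 0 < δ → ∃ C : ℝ, 0 < C ∧ ∀ a b c : ℕ,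
      Literature.NumberTheory.DiophantineGeometry.IsABCTriple a b c →
      ((a * b * c).primeFactors.filter (fun p => 5 ≤ (a * b * c).factorization p)).card ≤ K →
      ((UniqueFactorizationMonoid.radical a : ℕ) : ℝ) ^ (1 + δ) * (c : ℝ) ^ δ < (a : ℝ) →
      ((UniqueFactorizationMonoid.radical b : ℕ) : ℝ) ^ (1 + δ) * (c : ℝ) ^ δ < (b : ℝ) →
      ((UniqueFactorizationMonoid.radical c : ℕ) : ℝ) ^ (1 + δ) * (c : ℝ) ^ δ < (c : ℝ) →
      (c : ℝ) < C * ((Literature.NumberTheory.DiophantineGeometry.rad a b c : ℕ) : ℝ) ^ (1 + δ)) ↔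
    (∀ K : ℕ, ∀ δ : ℝ, 0 < δ → ∀ θ : ℝ, 0 < θ → θ * (1 + δ) < δ → ∃ y : ℕ, ∃ C : ℝ, 0 < C ∧
      ∀ a b c : ℕ, Literature.NumberTheory.DiophantineGeometry.IsABCTriple a b c →
      ((a * b * c).primeFactors.filter (fun p => 5 ≤ (a * b * c).factorization p)).card ≤ K →
      ((UniqueFactorizationMonoid.radical a : ℕ) : ℝ) ^ (1 + δ) * (c : ℝ) ^ δ < (a : ℝ) →
      ((UniqueFactorizationMonoid.radical b : ℕ) : ℝ) ^ (1 + δ) * (c : ℝ) ^ δ < (b : ℝ) →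
      ((UniqueFactorizationMonoid.radical c : ℕ) : ℝ) ^ (1 + δ) * (c : ℝ) ^ δ < (c : ℝ) →
        θ * Real.log c ≤
          ∑ p ∈ (a * b * c).primeFactors.filter (fun p => ¬ p ≤ y),
            (((a * b * c).factorization p : ℝ) - 1) * Real.log p →
        (c : ℝ) < C * ((Literature.NumberTheory.DiophantineGeometry.rad a b c : ℕ) : ℝ) ^ (1 + δ)) :=
  ridoutLocal_allPowerRich_iff

end Summit.ABC.ABC.Theorems.DepthCountedABC
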